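import Summits.Ventures.PercRepro.MatroidColoopStep

/-!
# PercRepro — Lemma J in the WINDOWED level-wise form (typer-2, gen 6; ref-2 K8-1 repair)

(`M ＼ {e}` is written `M.delete {e}`: inside `namespace PercRepro.Matroid`, once that namespace exists,
`open scoped Matroid` resolves to `PercRepro.Matroid` and the scoped notation is not available.)

`MatroidColoopStep.lean` states the level-wise form (R1) at EVERY level `u` (`Levelwise`); the theorems that
produce (R1) — mine-2's §10 / p3's `c025_levelwise_q_one_of_simple` — only give the levels `q ≤ u ≤ p`
(ref-2 K8-1: the all-`u` form is false on `U_{3,5}` at `(3, 1)`, `u = 0`). This file repeats Lemma J for the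
windowed predicate **`LevelwiseOn M p q`** (`∀ u, q ≤ u → u ≤ p → C(p+q, u) · #U(p, q) ≤ C(p+q, p) · W_u`):

* **`topCount_le_levelCount_top`** / **`topCount_le_levelCount_bot`** — `#U(p, q) ≤ W_p` (`A ↦ A`) and
  `#U(p, q) ≤ W_q` (`A ↦ E ∖ A`), hence the two BOUNDARY levels **`levelwise_top`**, **`levelwise_bot`** hold
  for every finite matroid unconditionally (`C(p+q, q) = C(p+q, p)`);
* **`levelwiseOn_of_isColoop`** — LEMMA J, windowed: the interior levels `q + 1 < u < p + 1` of `M` use the four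
  windowed instances of `M ＼ {e}` (levels `u`, `u − 1` of the pairs `(p, q + 1)` and `(p + 1, q)`, all inside
  their windows) and Pascal; the two boundary levels are the trivial injections;
* **`levelwiseOn_zero_of_isColoop`**, **`levelwiseOn_iff_of_isLoop`** — the `q = 0` and loop versions.
-/

namespace PercRepro

open Set

namespace Matroid

variable {α : Type*} {M : _root_.Matroid α}

/-- **The windowed level-wise form (R1)** for the pair `(p, q)`: `C(p+q, u) · #U(p, q) ≤ C(p+q, p) · W_u` for
every level `q ≤ u ≤ p` (the form mine-2's §10 and p3's `c025_levelwise_q_one_of_simple` produce). -/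
def LevelwiseOn (M : _root_.Matroid α) (p q : ℕ) : Prop :=
  ∀ u : ℕ, q ≤ u → u ≤ p → (p + q).choose u * topCount M p q ≤ (p + q).choose p * levelCount M u

/-- The all-level form implies the windowed one. -/
theorem LevelwiseOn.of_levelwise {p q : ℕ} (h : Levelwise M p q) : LevelwiseOn M p q :=
  fun u _ _ => h u

variable [M.Finite]

/-- `#U(p, q) ≤ W_p`: every `A ∈ U(p, q)` has rank `p` (the injection `A ↦ A`). -/
theorem topCount_le_levelCount_top (p q : ℕ) : topCount M p q ≤ levelCount M p := by
  unfold topCount levelCount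
  exact Set.ncard_le_ncard (fun A hA => ⟨hA.1, hA.2.1⟩)
    (M.ground_finite.finite_subsets.subset fun S hS => hS.1)

/-- `#U(p, q) ≤ W_q`: `A ↦ E ∖ A` is an injection of `U(p, q)` into the sets of rank `q`. -/
theorem topCount_le_levelCount_bot (p q : ℕ) : topCount M p q ≤ levelCount M q := by
  unfold topCount levelCount
  have hinj : Set.InjOn (fun A : Set α => M.E \ A)
      {A : Set α | A ⊆ M.E ∧ M.eRk A = (p : ℕ∞) ∧ M.eRk (M.E \ A) = (q : ℕ∞)} := by
    intro A hA B hB hAB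
    simp only at hAB
    rw [← Set.sdiff_sdiff_cancel_left hA.1, hAB, Set.sdiff_sdiff_cancel_left hB.1]
  have himg : (fun A : Set α => M.E \ A) ''
      {A : Set α | A ⊆ M.E ∧ M.eRk A = (p : ℕ∞) ∧ M.eRk (M.E \ A) = (q : ℕ∞)} ⊆
      {S : Set α | S ⊆ M.E ∧ M.eRk S = (q : ℕ∞)} := by
    rintro _ ⟨A, hA, rfl⟩
    exact ⟨Set.sdiff_subset, hA.2.2⟩
  rw [← hinj.ncard_image]
  exact Set.ncard_le_ncard himg (M.ground_finite.finite_subsets.subset fun S hS => hS.1)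

/-- **The top boundary level `u = p`** of the level-wise form holds for every finite matroid. -/
theorem levelwise_top (p q : ℕ) :
    (p + q).choose p * topCount M p q ≤ (p + q).choose p * levelCount M p :=
  Nat.mul_le_mul_left _ (topCount_le_levelCount_top p q)

/-- **The bottom boundary level `u = q`** of the level-wise form holds for every finite matroid
(`C(p+q, q) = C(p+q, p)`). -/
theorem levelwise_bot (p q : ℕ) :
    (p + q).choose q * topCount M p q ≤ (p + q).choose p * levelCount M q := by
  have h : (p + q).choose q = (p + q).choose p := Nat.choose_symm_add.symm
  rw [h]
  exact Nat.mul_le_mul_left _ (topCount_le_levelCount_bot p q)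

section Coloop

variable {e : α} (he : M.IsColoop e)
include he

/-- **Lemma J, windowed** (mine-2 §10; ref-2 K8-1): if `e` is a coloop and `M ＼ {e}` satisfies the windowed
level-wise form for `(p, q + 1)` and `(p + 1, q)`, then `M` satisfies it for `(p + 1, q + 1)`: the interior levels
by Pascal from the four windowed instances, the two boundary levels by the trivial injections. -/
theorem levelwiseOn_of_isColoop (p q : ℕ) (h1 : LevelwiseOn (M.delete {e}) p (q + 1))
    (h2 : LevelwiseOn (M.delete {e}) (p + 1) q) : LevelwiseOn M (p + 1) (q + 1) := by
  intro u hqu hup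
  rcases hup.lt_or_eq with hup | rfl
  · rcases hqu.lt_or_eq with hqu | rfl
    · -- interior: `q + 1 < u < p + 1`
      obtain ⟨u, rfl⟩ : ∃ v, u = v + 1 := ⟨u - 1, by omega⟩
      rw [topCount_succ_succ_eq_of_isColoop he, levelCount_succ_eq_of_isColoop he]
      have hn : p + 1 + (q + 1) = (p + (q + 1)) + 1 := by ring
      have hn' : p + 1 + q = p + (q + 1) := by ring
      rw [hn, Nat.choose_succ_succ, Nat.choose_succ_succ]
      have a1 := h1 (u + 1) (by omega) (by omega)
      have a1' := h1 u (by omega) (by omega)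
      have a2 := h2 (u + 1) (by omega) (by omega)
      have a2' := h2 u (by omega) (by omega)
      rw [hn'] at a2 a2'
      nlinarith [a1, a1', a2, a2']
    · -- the bottom boundary `u = q + 1`
      exact levelwise_bot (p + 1) (q + 1)
  · -- the top boundary `u = p + 1`
    exact levelwise_top (p + 1) (q + 1)

/-- **Lemma J at `q = 0`, windowed**: if `M ＼ {e}` satisfies the windowed level-wise form for `(p, 0)`, so does
`M` for `(p + 1, 0)`. -/
theorem levelwiseOn_zero_of_isColoop (p : ℕ) (h1 : LevelwiseOn (M.delete {e}) p 0) :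
    LevelwiseOn M (p + 1) 0 := by
  intro u _ hup
  rcases hup.lt_or_eq with hup | rfl
  · rw [topCount_succ_zero_eq_of_isColoop he]
    rcases u with _ | u
    · rw [levelCount_zero_eq_of_isColoop he, Nat.choose_zero_right, Nat.choose_self]
      have a1 := h1 0 le_rfl (Nat.zero_le _)
      rw [Nat.choose_zero_right, Nat.add_zero, Nat.choose_self] at a1
      simpa using a1
    · rw [levelCount_succ_eq_of_isColoop he, Nat.add_zero, Nat.choose_succ_succ, Nat.choose_self]
      have a1 := h1 (u + 1) (Nat.zero_le _) (by omega)
      have a1' := h1 u (Nat.zero_le _) (by omega)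
      rw [Nat.add_zero, Nat.choose_self] at a1 a1'
      nlinarith [a1, a1']
  · exact levelwise_top (p + 1) 0

end Coloop

section Loop

variable {e : α} (he : M.IsLoop e)
include he

/-- **Loops do not matter, windowed**: the windowed level-wise form for `M ＼ {e}` (`e` a loop) is the one for
`M`. -/
theorem levelwiseOn_iff_of_isLoop (p q : ℕ) : LevelwiseOn M p q ↔ LevelwiseOn (M.delete {e}) p q := by
  unfold LevelwiseOn
  refine forall_congr' fun u => ?_
  refine imp_congr_right fun _ => imp_congr_right fun _ => ?_
  rw [levelCount_eq_of_isLoop he, topCount_eq_of_isLoop he]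
  constructor
  · intro h
    nlinarith [h]
  · intro h
    nlinarith [h]

end Loop

end Matroid

end PercRepro
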